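import Literature.MathematicalPhysics.QuantumFieldTheory.Balaban1983to89.B8Ineq159CurvedCubeMemberLocalTower
import Literature.MathematicalPhysics.QuantumFieldTheory.Balaban1983to89.B8TorusShiftLandau
import Literature.MathematicalPhysics.QuantumFieldTheory.Balaban1983to89.B7TranslationCovariance

/-!
# `Balaban1983to89.B8Ineq159CurvedCubeMemberShift` — [Balaban1985RegularSpaces] (1.59) p. 86 on the cube member: TRANSLATION COVARIANCE IN THE POSITION
# OF THE MEMBER.  The member's (1.59) statement (Landau condition (1.38) on the `Λ′`-tower, data (1.55)∕`Q_j`∕outer layer, targets (1.62), smallness of the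
# plaquettes touching `□₀`) at the cube `□(a + w)` is the statement at `□(a)` for the data translated by `Lᵏw` ([Balaban1987RG1] (4.16) `t_a`); hence
# per-member constants may be chosen INDEPENDENT OF THE POSITION `a`

statement-level skeleton of published theorems with citation tags; proofs where landed; nothing here is a claim about the
Yang–Mills mass gap

`[Balaban1985RegularSpaces]` ("B8", CMP **99** (1985) 75–102) (1.1)–(1.2) p. 76, p. 77 (touching convention), (1.31) p. 82, (1.38) p. 82, (1.55) p. 86,
(1.59) p. 86, (1.62) p. 87, (1.68) p. 88, (1.131) p. 99, p. 98; [4] = `[Balaban1985BackgroundPropagators]` (3.19) p. 393, (3.23)–(3.25) p. 394; [B7] =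
`[Balaban1985Averaging]` (127) p. 37; `[Balaban1987RG1]` (4.16) p. 285 (the translations `t_a`).

CITATION HEADER (lean-in-tree rule).  Cell `pub-ymgap` (YM Track A, HUMAN RULING D-0062 ∕ D-0149), DAG node N05 = [B8], width seat `pub-ymgap-dag-n05-w3`
(g3), CLAIM-1 file (T).  WHY.  The per-member constants of this seat's curved (1.59) (files (D)–(H), (V), (S)) are produced member by member, the member
datum including the position `a ∈ ℤᵈ` of the cube; g2's ■ line listed «position-independence of the per-member constants (equivariance bookkeeping)» as
open.  The tree already has the translations `t_a` (`B12Ineq417Flat.shiftCfg`) and the covariance of every stencil involved (`B8TorusShiftStencils`,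
`B8TorusShiftLandau.QprimeT_shiftCfg`, `B7TranslationCovariance.linCovIter_shiftCfg`).  THIS FILE does the member's geometry under `a ↦ a + w` and proves the
TRANSPORT: the whole (1.59) statement at `□(a + w)` follows from the one at `□(a)` with the SAME constants.

THE MATHEMATICS (kernel-checked).  §1 geometry: `bLo_add`, `bHi_add`, `sqLo_add`, `sqHi_add`, `inLo_add`, `inHi_add` (corners shift by `L^{k−j}w`),
private `inBox_add_iff` (twin of a Summits-side lemma), `mem_cube_add_iff` (`x + Lᵏw ∈ □_j(a + w) ↔ x ∈ □_j(a)`, `j ≤ k`), `mem_cubeFam_add_iff`, `cubeFam_eq_preimage`, `mem_cubeLamS_add_iff`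
(level-`j` sites shift by `L^{k−j}w`), `mem_cubeLamBP_add_iff`; §2 touching under translation: `plaqTouches_preimage_iff`, `bondTouches_preimage_iff`,
`sideTouches_preimage_iff`; §3 `plaqF_shiftCfg`, `Jcur_shiftCfg`, `indicator_preimage_shiftCfg`, ★ `isLandau138_cube_shiftCfg` ((1.38) on the member's
`Λ′`-tower is translation covariant, multiplier translated level by level); §4 ★★★ `curved159_perCube_shift` — THE TRANSPORT: for any subgroup `H`,
truncation `m ≤ k`, spacing `η` and constants `(α₀, B)`, the member's full (1.59) implication at `□(a)` implies the one at `□(a + w)`.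

HONEST SCOPE ∕ A6.  Translation bookkeeping only; the consumer (this seat's uniformity corollaries) chooses the constants of the member at the origin.
Count-neutral; N05 NOT discharged; no count claim; one finite `𝕋⁴` programme at fixed `ε`, Bałaban as printed; the YM mass gap (Clay) is NOT proved by
any of this — R4 closes the conditional finite-`𝕋⁴` rung `BalabanLadder.UV` only; nothing continuum ∕ ℝ⁴ ∕ OS.  No `sorry`, no `def`, no `instance`, no
`notation`.  Unit `pub-ymgap-dag-n05-w3` (g3), 2026-08-28.
-/

noncomputable section

namespace Literature.MathematicalPhysics.QuantumFieldTheory.Balaban1983to89.B8Ineq159CurvedCubeMemberShift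

open B7Prop1Explicit B7Prop2Explicit B7Prop1Local
open B7Prop4GeneralLevels (linCovIter)
open B8Ineq132 (covDerivFwd BondTouches PlaqTouches plaqF)
open B8Eq140Level (SideTouches IsSide)
open B8Eq143PlaqExpansion (pdiv)
open B8Eq146AExpansion (iEta plaqCovDeriv)
open B8Eq155JBound (Jcur)
open B8Eq138LandauZd (IsLandau138 covLap covDivB QprimeT QT)
open B8Eq131Cubes (cube sqLo sqHi inLo inHi bLo bHi)
open B8Eq131CubesAdmissible (cubeFam)
open B8CubeMemberZd (cubeLamS cubeLam cubeLamS_of_lt cubeLamS_self cubeLamS_of_gt)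
open B8Ineq159FlatCubeMemberPrinted (cubeLamBP)
open B12Ineq417Flat (shiftCfg shiftCfg_apply)
open B8TorusShiftStencils (covDerivFwd_shiftCfg covLap_shiftCfg covDivB_shiftCfg pdiv_plaqCovDeriv_shiftCfg)
open B8TorusShiftLandau (QprimeT_shiftCfg)
open B7TranslationCovariance (linCovIter_shiftCfg)
open B8Ineq130 (tlo thi tlo_apply thi_apply)

-- `Site` alone would resolve to the torus sites of `Setup.lean`; re-export the `ℤ^d` sites of `B7Prop1Explicit`.
export B7Prop1Explicit (Site)

variable {d : ℕ}

/-! ## §1 Geometry of the member under `a ↦ a + w` -/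

section Geometry

/-- Corners shift: `bLo L (a + w) n m = bLo L a n m + Lⁿw`. [cite: Balaban1985RegularSpaces, (1.131) p.99] -/
theorem bLo_add (L : ℕ) (a w : Site d) (n m : ℕ) : bLo L (a + w) n m = bLo L a n m + ((L : ℤ) ^ n) • w := by
  funext i; simp only [bLo, Pi.add_apply, Pi.smul_apply, smul_eq_mul]; ring

/-- Corners shift: `bHi L (a + w) M n m = bHi L a M n m + Lⁿw`. [cite: Balaban1985RegularSpaces, (1.131) p.99] -/
theorem bHi_add (L : ℕ) (a w : Site d) (M n m : ℕ) : bHi L (a + w) M n m = bHi L a M n m + ((L : ℤ) ^ n) • w := by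
  funext i; simp only [bHi, Pi.add_apply, Pi.smul_apply, smul_eq_mul]; ring

/-- `sqLo_j(a + w) = sqLo_j(a) + L^{k−j}w`. [cite: Balaban1985RegularSpaces, (1.131) p.99, p.98] -/
theorem sqLo_add (L : ℕ) (a w : Site d) (ρ k j : ℕ) : sqLo L (a + w) ρ k j = sqLo L a ρ k j + ((L : ℤ) ^ (k - j)) • w := bLo_add L a w _ _

/-- `sqHi_j(a + w) = sqHi_j(a) + L^{k−j}w`. [cite: Balaban1985RegularSpaces, (1.131) p.99, p.98] -/
theorem sqHi_add (L : ℕ) (a w : Site d) (M ρ k j : ℕ) : sqHi L (a + w) M ρ k j = sqHi L a M ρ k j + ((L : ℤ) ^ (k - j)) • w :=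
  bHi_add L a w M _ _

/-- `inLo_j(a + w) = inLo_j(a) + L^{k−j}w`. [cite: Balaban1985RegularSpaces, (1.131) p.99] -/
theorem inLo_add (L : ℕ) (a w : Site d) (ρ k j : ℕ) : inLo L (a + w) ρ k j = inLo L a ρ k j + ((L : ℤ) ^ (k - j)) • w := bLo_add L a w _ _

/-- `inHi_j(a + w) = inHi_j(a) + L^{k−j}w`. [cite: Balaban1985RegularSpaces, (1.131) p.99] -/
theorem inHi_add (L : ℕ) (a w : Site d) (M ρ k j : ℕ) : inHi L (a + w) M ρ k j = inHi L a M ρ k j + ((L : ℤ) ^ (k - j)) • w :=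
  bHi_add L a w M _ _

/-- A box and a point translated together (the translations `t_a` of [Balaban1987RG1] (4.16) act on boxes). [cite: Balaban1987RG1, (4.16) p.285] -/
private theorem inBox_add_iff (lo hi x u : Site d) : InBox (lo + u) (hi + u) (x + u) ↔ InBox lo hi x := by
  simp only [InBox, Pi.add_apply, add_le_add_iff_right]

/-- **`x + Lᵏw ∈ □_j(a + w) ↔ x ∈ □_j(a)`** (`j ≤ k`; `□_j` is the `Lʲ`-blow-up of `[sqLo_j, sqHi_j]`). [cite: Balaban1985RegularSpaces, p.98, (1.131) p.99] -/
theorem mem_cube_add_iff {L : ℕ} (a w : Site d) (M ρ : ℕ) {k j : ℕ} (hjk : j ≤ k) (x : Site d) :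
    x + ((L : ℤ) ^ k) • w ∈ cube L (a + w) M ρ k j ↔ x ∈ cube L a M ρ k j := by
  have hpow : (L : ℤ) ^ j * (L : ℤ) ^ (k - j) = (L : ℤ) ^ k := by rw [← pow_add, Nat.add_sub_cancel' hjk]
  show InBox _ _ _ ↔ InBox _ _ _
  have hlo : tlo L (sqLo L (a + w) ρ k j) j = tlo L (sqLo L a ρ k j) j + ((L : ℤ) ^ k) • w := by
    funext i; rw [tlo_apply, Pi.add_apply, tlo_apply, sqLo_add, Pi.add_apply, Pi.smul_apply, Pi.smul_apply, smul_eq_mul, smul_eq_mul, mul_add,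
      ← mul_assoc, hpow]
  have hhi : thi L (sqHi L (a + w) M ρ k j) j = thi L (sqHi L a M ρ k j) j + ((L : ℤ) ^ k) • w := by
    funext i; rw [thi_apply, Pi.add_apply, thi_apply, sqHi_add, Pi.add_apply, Pi.smul_apply, Pi.smul_apply, smul_eq_mul, smul_eq_mul]
    linear_combination (w i) * hpow
  rw [hlo, hhi, inBox_add_iff]

/-- The member's domain sequence under `a ↦ a + w`: `x + Lᵏw ∈ Ω_j(a + w) ↔ x ∈ Ω_j(a)`. [cite: Balaban1985RegularSpaces, p.99, (1.131) p.99] -/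
theorem mem_cubeFam_add_iff {L : ℕ} (a w : Site d) (M ρ k j : ℕ) (x : Site d) :
    x + ((L : ℤ) ^ k) • w ∈ cubeFam false L (a + w) M ρ k j ↔ x ∈ cubeFam false L a M ρ k j := by
  by_cases hjk : j ≤ k
  · rw [B8Eq131CubesAdmissible.cubeFam_false_of_le L (a + w) M ρ hjk, B8Eq131CubesAdmissible.cubeFam_false_of_le L a M ρ hjk]
    exact mem_cube_add_iff a w M ρ hjk x
  · simp [cubeFam, hjk]

/-- `Ω_j(a)` as the preimage of `Ω_j(a + w)` under `x ↦ x + Lᵏw`. [cite: Balaban1985RegularSpaces, p.99] -/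
theorem cubeFam_eq_preimage {L : ℕ} (a w : Site d) (M ρ k j : ℕ) :
    cubeFam false L a M ρ k j = {x | x + ((L : ℤ) ^ k) • w ∈ cubeFam false L (a + w) M ρ k j} :=
  Set.ext fun x => (mem_cubeFam_add_iff a w M ρ k j x).symm

/-- **The `Λ′`-tower shifts by `L^{k−j}w` at level `j`**: `y + L^{k−j}w ∈ Λ′_j(a + w) ↔ y ∈ Λ′_j(a)` (truncation `m`).
[cite: Balaban1985RegularSpaces, (1.68) p.88, (1.131) p.99] -/
theorem mem_cubeLamS_add_iff (L : ℕ) (a w : Site d) (M ρ k m j : ℕ) (y : Site d) :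
    y + ((L : ℤ) ^ (k - j)) • w ∈ cubeLamS L (a + w) M ρ k m j ↔ y ∈ cubeLamS L a M ρ k m j := by
  rcases lt_trichotomy j m with hj | rfl | hj
  · rw [cubeLamS_of_lt L (a + w) M ρ k hj, cubeLamS_of_lt L a M ρ k hj]
    simp only [cubeLam, Set.mem_setOf_eq, sqLo_add, sqHi_add, inLo_add, inHi_add, inBox_add_iff]
  · rw [cubeLamS_self, cubeLamS_self]
    simp only [Set.mem_setOf_eq, sqLo_add, sqHi_add, inBox_add_iff]
  · rw [cubeLamS_of_gt L (a + w) M ρ k hj, cubeLamS_of_gt L a M ρ k hj]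
    simp

/-- **Print's class shifts by `L^{k−j}w` at level `j`**: `(c₋ + L^{k−j}w, κ) ∈ 𝔅_j(a + w) ↔ (c₋, κ) ∈ 𝔅_j(a)`.
[cite: Balaban1985RegularSpaces, (1.31) p.82, (1.131) p.99; Balaban1984PropagatorsII, (2.3) p.224] -/
theorem mem_cubeLamBP_add_iff (L : ℕ) (a w : Site d) (M ρ k m j : ℕ) (c : Site d × Fin d) :
    (c.1 + ((L : ℤ) ^ (k - j)) • w, c.2) ∈ cubeLamBP L (a + w) M ρ k m j ↔ c ∈ cubeLamBP L a M ρ k m j := by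
  simp only [B8Ineq159FlatCubeMemberPrinted.mem_cubeLamBP_iff, sqLo_add, sqHi_add, inLo_add, inHi_add, add_right_comm c.1 _ (e c.2),
    inBox_add_iff]

end Geometry

/-! ## §2 Touching under translation -/

section Touching

/-- `p_{κμ}(z)` touches the preimage iff `p_{κμ}(z + u)` touches the set. [cite: Balaban1985RegularSpaces, p.77 (touching convention)] -/
theorem plaqTouches_preimage_iff (S : Set (Site d)) (u z : Site d) (κ μ : Fin d) :
    PlaqTouches {x | x + u ∈ S} z κ μ ↔ PlaqTouches S (z + u) κ μ := by
  simp only [PlaqTouches, Set.mem_setOf_eq, add_right_comm _ (e _) u]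

/-- `⟨y, y + e_τ⟩` touches the preimage iff `⟨y + u, y + u + e_τ⟩` touches the set. [cite: Balaban1985RegularSpaces, p.77 (touching convention)] -/
theorem bondTouches_preimage_iff (S : Set (Site d)) (u y : Site d) (τ : Fin d) :
    BondTouches {x | x + u ∈ S} y τ ↔ BondTouches S (y + u) τ := by
  simp only [BondTouches, Set.mem_setOf_eq, add_right_comm _ (e _) u]

/-- `⟨y, y + e_τ⟩` side-touches the preimage iff `⟨y + u, y + u + e_τ⟩` side-touches the set. [cite: Balaban1985RegularSpaces, p.77 (touching convention), (1.2) p.76] -/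
theorem sideTouches_preimage_iff (S : Set (Site d)) (u y : Site d) (τ : Fin d) :
    SideTouches {x | x + u ∈ S} y τ ↔ SideTouches S (y + u) τ := by
  constructor
  · rintro ⟨z, κ, ν, hκν, hp, hs⟩
    refine ⟨z + u, κ, ν, hκν, (plaqTouches_preimage_iff S u z κ ν).1 hp, ?_⟩
    rcases hs with ⟨rfl, rfl⟩ | ⟨rfl, rfl⟩ | ⟨rfl, rfl⟩ | ⟨rfl, rfl⟩
    · exact Or.inl ⟨rfl, rfl⟩
    · exact Or.inr (Or.inl ⟨add_right_comm _ _ _, rfl⟩)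
    · exact Or.inr (Or.inr (Or.inl ⟨add_right_comm _ _ _, rfl⟩))
    · exact Or.inr (Or.inr (Or.inr ⟨rfl, rfl⟩))
  · rintro ⟨z, κ, ν, hκν, hp, hs⟩
    refine ⟨z - u, κ, ν, hκν, (plaqTouches_preimage_iff S u (z - u) κ ν).2 (by rw [sub_add_cancel]; exact hp), ?_⟩
    rcases hs with ⟨h, rfl⟩ | ⟨h, rfl⟩ | ⟨h, rfl⟩ | ⟨h, rfl⟩
    · exact Or.inl ⟨by rw [eq_sub_iff_add_eq, h], rfl⟩
    · exact Or.inr (Or.inl ⟨by rw [sub_add_eq_add_sub, eq_sub_iff_add_eq, h], rfl⟩)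
    · exact Or.inr (Or.inr (Or.inl ⟨by rw [sub_add_eq_add_sub, eq_sub_iff_add_eq, h], rfl⟩))
    · exact Or.inr (Or.inr (Or.inr ⟨by rw [eq_sub_iff_add_eq, h], rfl⟩))

end Touching

/-! ## §3 The plaquette variables, the current and the Landau condition under translation -/

section Stencils

variable {𝔸 : Type*} [NormedRing 𝔸] [NormOneClass 𝔸] [NormedAlgebra ℂ 𝔸] [CompleteSpace 𝔸]

omit [NormOneClass 𝔸] [NormedAlgebra ℂ 𝔸] [CompleteSpace 𝔸] in
/-- `(t_uU)(∂p_{κμ}(z)) = U(∂p_{κμ}(z + u))`. [cite: Balaban1985RegularSpaces, (1.2) p.76; Balaban1987RG1, (4.16) p.285] -/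
theorem plaqF_shiftCfg (u : Site d) (U : Site d → Fin d → 𝔸ˣ) (κ μ : Fin d) (z : Site d) :
    plaqF (shiftCfg u U) κ μ z = plaqF U κ μ (z + u) := by
  unfold plaqF
  rw [B12Ineq417Flat.hol_shiftCfg]

omit [NormOneClass 𝔸] [CompleteSpace 𝔸] in
/-- **The current (1.55) is translation covariant**: `J_{t_uU₀}(t_uA)_μ(x) = J_{U₀}(A)_μ(x + u)`. [cite: Balaban1985RegularSpaces, (1.55) p.86; Balaban1987RG1, (4.16) p.285] -/
theorem Jcur_shiftCfg (η : ℝ) (u : Site d) (U₀ : Site d → Fin d → 𝔸ˣ) (A : Site d → Fin d → 𝔸) (μ : Fin d) (x : Site d) :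
    Jcur η (shiftCfg u U₀) (shiftCfg u A) μ x = Jcur η U₀ A μ (x + u) := by
  rw [B8Eq155JBound.Jcur_def, B8Eq155JBound.Jcur_def, pdiv_plaqCovDeriv_shiftCfg]

omit [NormOneClass 𝔸] [NormedAlgebra ℂ 𝔸] [CompleteSpace 𝔸] in
/-- Restriction to a preimage commutes with the translation `t_u` ((4.16)). [cite: Balaban1987RG1, (4.16) p.285] -/
theorem indicator_preimage_shiftCfg (S : Set (Site d)) (u : Site d) (g : Site d → 𝔸) :
    {x | x + u ∈ S}.indicator (shiftCfg u g) = shiftCfg u (S.indicator g) := by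
  classical
  funext x
  simp only [shiftCfg_apply, Set.indicator_apply, Set.mem_setOf_eq]

omit [NormOneClass 𝔸] in
/-- ★ **(1.38) ON THE MEMBER'S `Λ′`-TOWER IS TRANSLATION COVARIANT**: if `A` is in the curved Landau gauge of `U₀` for the member at `a + w` (multiplier form on
`Ω₀ = □₀(a + w)`, `Λ′`-tower `cubeLamS … (a + w) … m`), then `t_{Lᵏw}A` is in it for `t_{Lᵏw}U₀` and the member at `a` (multiplier translated level by level
by `L^{k−j}w`; `Q′_j(U₀)ᵀ` by `B8TorusShiftLandau.QprimeT_shiftCfg`, the stencil by `B8TorusShiftStencils`; `m ≤ k`, `1 ≤ L`).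
[cite: Balaban1985RegularSpaces, (1.38) p.82, (1.68) p.88; Balaban1985BackgroundPropagators, (3.19) p.393, (3.23)–(3.25) p.394; Balaban1987RG1, (4.16) p.285] -/
theorem isLandau138_cube_shiftCfg {L : ℕ} (hL : 1 ≤ L) (a w : Site d) (M ρ : ℕ) {k m : ℕ} (hmk : m ≤ k) (η : ℝ)
    {U₀ : Site d → Fin d → 𝔸ˣ} {A : Site d → Fin d → 𝔸}
    (h : IsLandau138 L m η (cubeFam false L (a + w) M ρ k 0) (cubeLamS L (a + w) M ρ k m) U₀ A) :
    IsLandau138 L m η (cubeFam false L a M ρ k 0) (cubeLamS L a M ρ k m)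
      (shiftCfg (((L : ℤ) ^ k) • w) U₀) (shiftCfg (((L : ℤ) ^ k) • w) A) := by
  classical
  obtain ⟨μ, hμ⟩ := h
  refine ⟨fun j => shiftCfg (((L : ℤ) ^ (k - j)) • w) (μ j), fun x hx => ?_⟩
  have hxv : x + ((L : ℤ) ^ k) • w ∈ cubeFam false L (a + w) M ρ k 0 := (mem_cubeFam_add_iff a w M ρ k 0 x).2 hx
  -- the stencil side
  have hdiv : covDivB η (shiftCfg (((L : ℤ) ^ k) • w) U₀) (shiftCfg (((L : ℤ) ^ k) • w) A) = shiftCfg (((L : ℤ) ^ k) • w) (covDivB η U₀ A) := by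
    funext z; rw [covDivB_shiftCfg, shiftCfg_apply]
  rw [hdiv, cubeFam_eq_preimage a w M ρ k 0, indicator_preimage_shiftCfg, covLap_shiftCfg, hμ _ hxv]
  -- the transpose side, level by level
  unfold QT
  refine Finset.sum_congr rfl fun j hj => ?_
  have hjm : j ≤ m := Nat.lt_succ_iff.1 (Finset.mem_range.1 hj)
  have hind : (cubeLamS L a M ρ k m j).indicator (shiftCfg (((L : ℤ) ^ (k - j)) • w) (μ j)) =
      shiftCfg (((L : ℤ) ^ (k - j)) • w) ((cubeLamS L (a + w) M ρ k m j).indicator (μ j)) := by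
    have hset : cubeLamS L a M ρ k m j = {y | y + ((L : ℤ) ^ (k - j)) • w ∈ cubeLamS L (a + w) M ρ k m j} :=
      Set.ext fun y => (mem_cubeLamS_add_iff L a w M ρ k m j y).symm
    rw [hset, indicator_preimage_shiftCfg]
  have hw : ((L : ℤ) ^ k) • w = ((L : ℤ) ^ j) • (((L : ℤ) ^ (k - j)) • w) := by
    rw [← mul_smul, ← pow_add, Nat.add_sub_cancel' (hjm.trans hmk)]
  rw [hind, hw, QprimeT_shiftCfg hL]

end Stencils

/-! ## §4 The transport of the member's (1.59) statement under `a ↦ a + w` -/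

section Transport

variable {𝔸 : Type*} [NormedRing 𝔸] [NormOneClass 𝔸] [NormedAlgebra ℂ 𝔸] [CompleteSpace 𝔸]

omit [NormOneClass 𝔸] in
set_option maxHeartbeats 400000 in
-- one long bookkeeping proof (eight hypothesis∕target conversions under the translation); twice the default budget, no heavy automation
/-- ★★★ **THE TRANSPORT.**  Fix a subgroup `H`, `1 ≤ L`, a truncation `m ≤ k`, a spacing `η` and constants `α₀, B`.  If the member at `a` satisfies «for every
`H`-valued `U₀` whose plaquettes touching `□₀(a)` are `α₀`-small, every `φ` in the curved Landau gauge (1.38) of `U₀` on the `Λ′`-tower of `□(a)` supported on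
the side-touching bonds, and every `N ≥ 0` bounding the data (1.55) ∕ `Q_j` ∕ outer layer, the (1.62) triple is `≤ B·N` on the sides of the `□_j(a)`, `j ≤ m`»,
then so does the member at `a + w`, with the SAME `α₀, B` — apply the hypothesis to `(t_{Lᵏw}U₀, t_{Lᵏw}φ)` (§1–§3: every set, datum and target of the member at
`a + w` is the corresponding one at `a` translated by `Lᵏw` on the fine lattice, by `L^{k−j}w` at level `j`).
[cite: Balaban1985RegularSpaces, (1.59) p.86, (1.62) p.87, (1.38) p.82, (1.55) p.86, (1.131) p.99, p.77; Balaban1985Averaging, (127) p.37; Balaban1985BackgroundPropagators, (3.19) p.393, (3.23)–(3.25) p.394; Balaban1987RG1, (4.16) p.285] -/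
theorem curved159_perCube_shift {H : Subgroup 𝔸ˣ} {L : ℕ} (hL : 1 ≤ L) (a w : Site d) (M ρ : ℕ) {k m : ℕ} (hmk : m ≤ k) {η α₀ B : ℝ}
    (Ha : ∀ (U₀ : Site d → Fin d → 𝔸ˣ), (∀ x κ, U₀ x κ ∈ H) →
      (∀ (z : Site d) (κ μ : Fin d), κ ≠ μ → PlaqTouches (cubeFam false L a M ρ k 0) z κ μ → ‖plaqF U₀ κ μ z - 1‖ ≤ α₀) →
      ∀ φ : Site d → Fin d → 𝔸,
        IsLandau138 L m η (cubeFam false L a M ρ k 0) (cubeLamS L a M ρ k m) U₀ φ →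
        (∀ (y : Site d) (τ : Fin d), (∀ j, j ≤ m → ¬ SideTouches (cubeFam false L a M ρ k j) y τ) → φ y τ = 0) →
        ∀ N : ℝ, 0 ≤ N →
          (∀ j, j ≤ m → ∀ (y : Site d) (τ : Fin d), BondTouches (cubeFam false L a M ρ k j) y τ →
              ((L : ℝ) ^ j * η) ^ 3 * ‖Jcur η U₀ φ τ y‖ ≤ N) →
          (∀ j, j ≤ m → ∀ c ∈ cubeLamBP L a M ρ k m j, ‖linCovIter L U₀ (iEta η φ) j c.1 c.2‖ ≤ N) →
          (∀ (y : Site d) (τ : Fin d), ¬ BondTouches (cubeFam false L a M ρ k 0) y τ → η * ‖φ y τ‖ ≤ N) →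
          ∀ j, j ≤ m → ∀ (y : Site d) (τ : Fin d), SideTouches (cubeFam false L a M ρ k j) y τ →
            ((L : ℝ) ^ j * η) * ‖φ y τ‖ ≤ B * N ∧
            (∀ ν : Fin d, ((L : ℝ) ^ j * η) ^ 2 * ‖covDerivFwd η U₀ ν (fun z => φ z τ) y‖ ≤ B * N) ∧
            ((L : ℝ) ^ j * η) ^ 3 * ‖covLap η U₀ (fun z => φ z τ) y‖ ≤ B * N) :
    ∀ (U₀ : Site d → Fin d → 𝔸ˣ), (∀ x κ, U₀ x κ ∈ H) →
      (∀ (z : Site d) (κ μ : Fin d), κ ≠ μ → PlaqTouches (cubeFam false L (a + w) M ρ k 0) z κ μ → ‖plaqF U₀ κ μ z - 1‖ ≤ α₀) →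
      ∀ φ : Site d → Fin d → 𝔸,
        IsLandau138 L m η (cubeFam false L (a + w) M ρ k 0) (cubeLamS L (a + w) M ρ k m) U₀ φ →
        (∀ (y : Site d) (τ : Fin d), (∀ j, j ≤ m → ¬ SideTouches (cubeFam false L (a + w) M ρ k j) y τ) → φ y τ = 0) →
        ∀ N : ℝ, 0 ≤ N →
          (∀ j, j ≤ m → ∀ (y : Site d) (τ : Fin d), BondTouches (cubeFam false L (a + w) M ρ k j) y τ →
              ((L : ℝ) ^ j * η) ^ 3 * ‖Jcur η U₀ φ τ y‖ ≤ N) →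
          (∀ j, j ≤ m → ∀ c ∈ cubeLamBP L (a + w) M ρ k m j, ‖linCovIter L U₀ (iEta η φ) j c.1 c.2‖ ≤ N) →
          (∀ (y : Site d) (τ : Fin d), ¬ BondTouches (cubeFam false L (a + w) M ρ k 0) y τ → η * ‖φ y τ‖ ≤ N) →
          ∀ j, j ≤ m → ∀ (y : Site d) (τ : Fin d), SideTouches (cubeFam false L (a + w) M ρ k j) y τ →
            ((L : ℝ) ^ j * η) * ‖φ y τ‖ ≤ B * N ∧
            (∀ ν : Fin d, ((L : ℝ) ^ j * η) ^ 2 * ‖covDerivFwd η U₀ ν (fun z => φ z τ) y‖ ≤ B * N) ∧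
            ((L : ℝ) ^ j * η) ^ 3 * ‖covLap η U₀ (fun z => φ z τ) y‖ ≤ B * N := by
  intro U₀ hU hP φ hLan hs N hN h1 h2 h3 j hj y τ hst
  -- the translation and the translated data
  obtain ⟨v, hv⟩ : ∃ v : Site d, v = ((L : ℤ) ^ k) • w := ⟨_, rfl⟩
  have hpre : ∀ j', cubeFam false L a M ρ k j' = {x | x + v ∈ cubeFam false L (a + w) M ρ k j'} := fun j' => by
    rw [hv]; exact cubeFam_eq_preimage a w M ρ k j'
  set U₀' : Site d → Fin d → 𝔸ˣ := shiftCfg v U₀ with hU₀'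
  set φ' : Site d → Fin d → 𝔸 := shiftCfg v φ with hφ'
  have hU' : ∀ x κ, U₀' x κ ∈ H := fun x κ => hU _ _
  have hP' : ∀ (z : Site d) (κ μ : Fin d), κ ≠ μ → PlaqTouches (cubeFam false L a M ρ k 0) z κ μ → ‖plaqF U₀' κ μ z - 1‖ ≤ α₀ := by
    intro z κ μ hκμ hpt
    rw [hU₀', plaqF_shiftCfg]
    rw [hpre 0, plaqTouches_preimage_iff] at hpt
    exact hP _ κ μ hκμ hpt
  have hLan' : IsLandau138 L m η (cubeFam false L a M ρ k 0) (cubeLamS L a M ρ k m) U₀' φ' := by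
    rw [hU₀', hφ', hv]; exact isLandau138_cube_shiftCfg hL a w M ρ hmk η hLan
  have hs' : ∀ (y : Site d) (τ : Fin d), (∀ j, j ≤ m → ¬ SideTouches (cubeFam false L a M ρ k j) y τ) → φ' y τ = 0 := by
    intro y' τ' hno
    rw [hφ', shiftCfg_apply]
    refine hs _ τ' fun j' hj' hst' => hno j' hj' ?_
    rw [hpre j', sideTouches_preimage_iff]; exact hst'
  have h1' : ∀ j, j ≤ m → ∀ (y : Site d) (τ : Fin d), BondTouches (cubeFam false L a M ρ k j) y τ →
      ((L : ℝ) ^ j * η) ^ 3 * ‖Jcur η U₀' φ' τ y‖ ≤ N := by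
    intro j' hj' y' τ' hbt
    rw [hU₀', hφ', Jcur_shiftCfg]
    rw [hpre j', bondTouches_preimage_iff] at hbt
    exact h1 j' hj' _ τ' hbt
  have h2' : ∀ j, j ≤ m → ∀ c ∈ cubeLamBP L a M ρ k m j, ‖linCovIter L U₀' (iEta η φ') j c.1 c.2‖ ≤ N := by
    intro j' hj' c hc
    have hiEta : iEta η φ' = shiftCfg v (iEta η φ) := by funext z κ; rfl
    have hvj : v = ((L : ℤ) ^ j') • (((L : ℤ) ^ (k - j')) • w) := by
      rw [hv, ← mul_smul, ← pow_add, Nat.add_sub_cancel' (hj'.trans hmk)]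
    rw [hiEta, hU₀', hvj, ← linCovIter_shiftCfg]
    exact h2 j' hj' _ ((mem_cubeLamBP_add_iff L a w M ρ k m j' c).2 hc)
  have h3' : ∀ (y : Site d) (τ : Fin d), ¬ BondTouches (cubeFam false L a M ρ k 0) y τ → η * ‖φ' y τ‖ ≤ N := by
    intro y' τ' hno
    rw [hφ', shiftCfg_apply]
    refine h3 _ τ' fun hbt => hno ?_
    rw [hpre 0, bondTouches_preimage_iff]; exact hbt
  -- the hypothesis at `a`, read at the translated bond `y − v`
  have hst' : SideTouches (cubeFam false L a M ρ k j) (y - v) τ := by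
    rw [hpre j, sideTouches_preimage_iff, sub_add_cancel]; exact hst
  obtain ⟨t1, t2, t3⟩ := Ha U₀' hU' hP' φ' hLan' hs' N hN h1' h2' h3' j hj (y - v) τ hst'
  refine ⟨?_, fun ν => ?_, ?_⟩
  · rw [hφ', shiftCfg_apply, sub_add_cancel] at t1; exact t1
  · have e : covDerivFwd η U₀' ν (fun z => φ' z τ) (y - v) = covDerivFwd η U₀ ν (fun z => φ z τ) y := by
      rw [hU₀', show (fun z => φ' z τ) = shiftCfg v (fun z => φ z τ) from rfl, covDerivFwd_shiftCfg, sub_add_cancel]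
    have t2ν := t2 ν
    rw [e] at t2ν; exact t2ν
  · have e : covLap η U₀' (fun z => φ' z τ) (y - v) = covLap η U₀ (fun z => φ z τ) y := by
      rw [hU₀', show (fun z => φ' z τ) = shiftCfg v (fun z => φ z τ) from rfl, covLap_shiftCfg, sub_add_cancel]
    rw [e] at t3; exact t3

end Transport

end Literature.MathematicalPhysics.QuantumFieldTheory.Balaban1983to89.B8Ineq159CurvedCubeMemberShift

end
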